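import Literature.NumberTheory.Sieve.GoldstonPintzYildirimTheta
import Literature.NumberTheory.Sieve.ParityWave0BombieriVinogradovProofs
import HarnessLib

/-!
# Goldston–Pintz–Yıldırım, *Primes in tuples I*, §9 (9.13)–(9.14): the Bombieri–Vinogradov step

Trunk: NumberTheory / Sieve. Continuation of `GoldstonPintzYildirimTheta` ((9.7)–(9.12)): the
error term `𝓔 = ∑_{d,e ≤ R}♭ nuJoint(d,e) E'(N,[d,e])` of (9.12) is estimated by Cauchy–Schwarz,
Lemma 2 and the Bombieri–Vinogradov theorem, giving GPY (9.14), the reduction of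
**Proposition 2** (unconditional range `R ≪ N^{1/4}(log N)^{−B(M)}`, `h ≤ R`) to its main term
`N 𝒯̃_R(H₁, H₂, ℓ₁, ℓ₂, h₀)` (D. A. Goldston, J. Pintz, C. Y. Yıldırım, *Primes in tuples. I*,
Ann. of Math. 170 (2009) = arXiv:math/0508185, §9, p. 19). Everything here is PROVED; the
Bombieri–Vinogradov theorem is the tree's `Literature.NumberTheory.Sieve.bombieri_vinogradov_holds`
(parity.S27, `ψ`-weighted), transported to GPY's `θ`-weighted form (1.2)–(1.3).

* `nuJoint_le_dGen_lcm`, `card_filter_lcm_eq_le`, `thetaErrSum_le` — regrouping by the modulus: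
  `𝓔 ≤ ∑♭_{q ≤ R²} d_{4k}(q) E'(N, q)` (`nuJoint ≤ d_k([d,e])`, at most `d_4(q)` pairs with
  `[d, e] = q`; the printed `∑♭ d_k(q) d_3(q) E'(N, q)`);
* `thetaErr_le_trivial` — "the trivial estimate `E'(N, q) ≤ (2N/q) log N`" in the form
  `E'(N, q) ≤ 2N(1 + log N) d_2(q)/q` (`q ≤ d_2(q) φ(q)` for squarefree `q`);
* `sum_dGen_sq_mul_thetaErr_le` — `∑♭_{q ≤ x} d_m(q)² E'(N,q) ≤ 2N(1+log N) D'(x, 2m²)` (Lemma 2);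
* `bombieriVinogradov_thetaErr` — **(1.3) with `ϑ = 1/2`** for `θ(N; q, a)` at `x = N`:
  `∑_{q ≤ N^{1/2}/(log N)^B} E'(N, q) ≤ C N/(log N)^A` (`N ≥ N₀`), from the `ψ`-form and
  Chebyshev's `ψ(N) − ϑ(N) ≤ 2√N log N`;
* `thetaErrSum_le_of_BV` — **(9.13)**: `𝓔 ≤ C N/(log N)^A` for `R² ≤ N^{1/2}/(log N)^B`,
  `B = B(A, M)`;
* `abs_sumTheta_sub_mainTRTheta_le_of_BV` — **(9.14)**: for all `M`, `A` there are `B > 0`, `C`,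
  `N₀` with `|S̃_R − N 𝒯̃_R| ≤ C N/(log N)^A` whenever `N ≥ N₀`, `1 ≤ R ≤ N^{1/4}/(log N)^B`,
  `h₀ ≤ R`, `H₁, H₂` not both empty, `k₁ + k₂ + ℓ₁ + ℓ₂ ≤ M`;
* `proposition2_of_mainTerm` — the last paragraph of §9: **`Literature.NumberTheory.Sieve.GPY.proposition2`
  follows from (9.14) and the main-term asymptotics of `𝒯̃_R`** (GPY (9.15)–(9.23) with Lemma 3,
  and the one-variable analogue when one of `H₁, H₂` is empty), the latter taken as an explicit
  HYPOTHESIS — this is exactly what remains to be proved for `proposition2_holds`.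

What is NOT here: the evaluation of `𝒯̃_R` ((9.15)–(9.23) with Lemma 3), i.e. the main terms of
Proposition 2 (the hypothesis of `proposition2_of_mainTerm`); and the conditional range
`R ≪ N^{ϑ/2−ε}` under a level of distribution `ϑ > 1/2`.

Design notes. `θ(x; q, a)` exists in the topic in other shapes — `thetaMod q a x` of
`BombieriFriedlanderIwaniecProofs.lean` (real `x`, via `primeInd`), `thetaAP` of
`PolymathThetaLevel.lean` (interval version), and the `chebyshevPsiMod` family of
`ParityWave0.lean` / `LevelOfDistribution.lean` (`ψ`-weighted) — the bridge used here is
`thetaMod_le_chebyshevPsiMod_and` (GPY's `thetaMod` of `GoldstonPintzYildirimTheta` against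
`ParityWave0.chebyshevPsiMod`, the summand of the tree's Bombieri–Vinogradov statement); a
librarian may consolidate the `θ`-variants.

## References

* D. A. Goldston, J. Pintz, C. Y. Yıldırım, *Primes in tuples. I*, Ann. of Math. (2) 170 (2009),
  819–862 = arXiv:math/0508185, §1 (1.2)–(1.3), §9 (9.12)–(9.14), p. 19.
  [cite: GoldstonPintzYildirim2009]
* E. Bombieri, *On the large sieve*, Mathematika 12 (1965), 201–225. [cite: Bombieri1965]
-/

noncomputable section

open Finset
open scoped ArithmeticFunction.Moebius ArithmeticFunction.omega

namespace Literature.NumberTheory.Sieve.GPY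

/-! ### Regrouping `𝓔` by the modulus `q = [d, e]` -/

/-- `nuJoint(d, e) ≤ k^{ω([d, e])} = d_k([d, e])`, `k = k₁ + k₂` (every local factor is `≤ k`; the
printed `d_k(a₁a₂a₁₂)` of (9.11)–(9.12)). [cite: GoldstonPintzYildirim2009, Section 9 eq. 9.12] -/
theorem nuJoint_le_dGen_lcm (H₁ H₂ : Finset ℕ) (d e : ℕ) :
    (nuJoint H₁ H₂ d e : ℝ) ≤ dGen ((#H₁ : ℝ) + #H₂) (Nat.lcm d e) := by
  have hω : ω (Nat.lcm d e) = (Nat.lcm d e).primeFactors.card := by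
    rw [ArithmeticFunction.cardDistinctFactors_apply, Nat.primeFactors, List.card_toFinset]
  have hloc : ∀ p, (nuJointPrime H₁ H₂ d e p : ℝ) ≤ (#H₁ : ℝ) + #H₂ := by
    intro p
    have h1 := nuPrime_le_card H₁ p
    have h2 := nuPrime_le_card H₂ p
    have h3 : nuBar H₁ H₂ p ≤ #H₁ := by
      rw [nuBar_eq_card_inter]
      exact (Finset.card_le_card Finset.inter_subset_left).trans Finset.card_image_le
    unfold nuJointPrime
    split_ifs <;> norm_cast <;> omega
  unfold nuJoint dGen
  rw [hω]
  push_cast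
  calc ∏ p ∈ (Nat.lcm d e).primeFactors, (nuJointPrime H₁ H₂ d e p : ℝ)
      ≤ ∏ _p ∈ (Nat.lcm d e).primeFactors, ((#H₁ : ℝ) + #H₂) :=
        Finset.prod_le_prod (fun p _ => by positivity) fun p _ => hloc p
    _ = _ := Finset.prod_const _

/-- `d_m(q) ≥ 0` for `m ≥ 0`. [folklore] -/
theorem dGen_nonneg {m : ℝ} (hm : 0 ≤ m) (q : ℕ) : 0 ≤ dGen m q := pow_nonneg hm _

/-- `d_m(q) ≥ 1` for `m ≥ 1`. [folklore] -/
theorem one_le_dGen {m : ℝ} (hm : 1 ≤ m) (q : ℕ) : 1 ≤ dGen m q := one_le_pow₀ hm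

/-- For squarefree `q`, the pairs `(d, e)` with `[d, e] = q` number at most
`#(divisors q)² = 4^{ω(q)} = d_4(q)` (GPY count them exactly: `d_3(q)` triples `q = a₁a₂a₁₂`).
[cite: GoldstonPintzYildirim2009, Section 9 eq. 9.13] -/
theorem card_filter_lcm_eq_le {q : ℕ} (hq : Squarefree q) (s : Finset (ℕ × ℕ)) :
    (#(s.filter fun de => Nat.lcm de.1 de.2 = q) : ℝ) ≤ dGen 4 q := by
  classical
  have hq0 := hq.ne_zero
  have hsub : s.filter (fun de => Nat.lcm de.1 de.2 = q) ⊆ q.divisors ×ˢ q.divisors := by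
    intro de hde
    rw [Finset.mem_filter] at hde
    rw [Finset.mem_product, Nat.mem_divisors, Nat.mem_divisors]
    refine ⟨⟨?_, hq0⟩, ⟨?_, hq0⟩⟩
    · rw [← hde.2]; exact Nat.dvd_lcm_left _ _
    · rw [← hde.2]; exact Nat.dvd_lcm_right _ _
  -- `#(divisors q) = 2^{ω(q)}` for squarefree `q` (= `MaynardSieve.card_divisors_of_squarefree`)
  have hcard : #(q.divisors) = 2 ^ ω q := by
    rw [Nat.card_divisors hq0, ArithmeticFunction.cardDistinctFactors_apply, ← List.card_toFinset,
      ← Finset.prod_const]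
    refine Finset.prod_congr rfl fun p hp => ?_
    have hp' := Nat.mem_primeFactors.1 hp
    have h1 : 1 ≤ q.factorization p := (Nat.Prime.dvd_iff_one_le_factorization hp'.1 hq0).1 hp'.2.1
    have h2 : q.factorization p ≤ 1 := (Nat.squarefree_iff_factorization_le_one hq0).1 hq p
    omega
  calc (#(s.filter fun de => Nat.lcm de.1 de.2 = q) : ℝ) ≤ #(q.divisors ×ˢ q.divisors) := by
        exact_mod_cast Finset.card_le_card hsub
    _ = (2 : ℝ) ^ ω q * 2 ^ ω q := by rw [Finset.card_product, hcard]; push_cast; ring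
    _ = dGen 4 q := by rw [dGen, ← mul_pow]; norm_num

/-- **Regrouping by the modulus** (the first two lines of (9.13)):
`𝓔 = ∑_{d,e ≤ R}♭ nuJoint(d,e) E'(N,[d,e]) ≤ ∑♭_{q ≤ R²} d_{4k}(q) E'(N, q)`
(`nuJoint ≤ d_k(q)`, at most `d_4(q)` pairs per `q`; GPY: `∑♭ d_k(q) d_3(q) E'(N,q)`).
[cite: GoldstonPintzYildirim2009, Section 9 eq. 9.13] -/
theorem thetaErrSum_le {R : ℝ} (hR : 1 ≤ R) (H₁ H₂ : Finset ℕ) (N : ℕ) :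
    thetaErrSum R H₁ H₂ N ≤
      ∑ q ∈ squarefreeLE (R ^ 2), dGen (4 * ((#H₁ : ℝ) + #H₂)) q * thetaErr N q := by
  classical
  set k : ℝ := (#H₁ : ℝ) + #H₂ with hk
  have hk0 : 0 ≤ k := by positivity
  set P := (Icc 1 ⌊R⌋₊ ×ˢ Icc 1 ⌊R⌋₊).filter
    (fun de : ℕ × ℕ => Squarefree de.1 ∧ Squarefree de.2) with hP
  have h1 : thetaErrSum R H₁ H₂ N =
      ∑ de ∈ P, (nuJoint H₁ H₂ de.1 de.2 : ℝ) * thetaErr N (Nat.lcm de.1 de.2) := by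
    rw [thetaErrSum, hP, Finset.sum_filter]
  have hmaps : ∀ de ∈ P, Nat.lcm de.1 de.2 ∈ squarefreeLE (R ^ 2) := by
    rintro ⟨d, e⟩ hde
    rw [hP, Finset.mem_filter, Finset.mem_product, Finset.mem_Icc, Finset.mem_Icc] at hde
    obtain ⟨⟨⟨hd1, hdR⟩, ⟨he1, heR⟩⟩, hsd, hse⟩ := hde
    dsimp only at hsd hse hd1 hdR he1 heR ⊢
    rw [mem_squarefreeLE]
    have hd0 := hsd.ne_zero
    have he0 := hse.ne_zero
    refine ⟨⟨Nat.pos_of_ne_zero (Nat.lcm_ne_zero hd0 he0), ?_⟩, ?_⟩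
    · have hle : Nat.lcm d e ≤ d * e := Nat.le_of_dvd (Nat.mul_pos hd1 he1) (Nat.lcm_dvd_mul d e)
      have hde' : d * e ≤ ⌊R⌋₊ * ⌊R⌋₊ := Nat.mul_le_mul hdR heR
      have hfl : ⌊R⌋₊ * ⌊R⌋₊ ≤ ⌊R ^ 2⌋₊ := by
        apply Nat.le_floor
        push_cast
        have h0 : (0 : ℝ) ≤ R := by linarith
        have hf := Nat.floor_le h0
        rw [sq]
        exact mul_le_mul hf hf (Nat.cast_nonneg _) h0
      omega
    · -- squarefree (= `MaynardSieve.squarefree_lcm`, not imported)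
      rw [Nat.squarefree_iff_factorization_le_one (Nat.lcm_ne_zero hd0 he0)]
      intro p
      rw [Nat.factorization_lcm hd0 he0, Finsupp.sup_apply]
      exact sup_le ((Nat.squarefree_iff_factorization_le_one hd0).mp hsd p)
        ((Nat.squarefree_iff_factorization_le_one he0).mp hse p)
  rw [h1, ← Finset.sum_fiberwise_of_maps_to hmaps]
  refine Finset.sum_le_sum fun q hq => ?_
  have hqsf : Squarefree q := (mem_squarefreeLE.1 hq).2
  have hE0 := thetaErr_nonneg N q
  calc ∑ de ∈ P.filter (fun de => Nat.lcm de.1 de.2 = q),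
        (nuJoint H₁ H₂ de.1 de.2 : ℝ) * thetaErr N (Nat.lcm de.1 de.2)
      ≤ ∑ _de ∈ P.filter (fun de => Nat.lcm de.1 de.2 = q), dGen k q * thetaErr N q := by
        refine Finset.sum_le_sum fun de hde => ?_
        have hq' : Nat.lcm de.1 de.2 = q := (Finset.mem_filter.1 hde).2
        have hν := nuJoint_le_dGen_lcm H₁ H₂ de.1 de.2
        rw [hq'] at hν ⊢
        exact mul_le_mul_of_nonneg_right hν hE0
    _ = #(P.filter (fun de => Nat.lcm de.1 de.2 = q)) * (dGen k q * thetaErr N q) := by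
        rw [Finset.sum_const, nsmul_eq_mul]
    _ ≤ dGen 4 q * (dGen k q * thetaErr N q) :=
        mul_le_mul_of_nonneg_right (card_filter_lcm_eq_le hqsf P)
          (mul_nonneg (dGen_nonneg hk0 q) hE0)
    _ = dGen (4 * k) q * thetaErr N q := by rw [← mul_assoc, dGen_mul]

/-! ### The trivial estimate `E'(N, q) ≤ 2N(1 + log N) d_2(q)/q` -/

/-- At most `N/q + 1` integers `1 ≤ x ≤ N` lie in a given class modulo `q ≥ 1`. [folklore] -/
theorem card_filter_Icc_natCast_eq_le {q : ℕ} (hq : 0 < q) (a : ZMod q) (N : ℕ) :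
    #((Icc 1 N).filter fun x : ℕ => (x : ZMod q) = a) ≤ N / q + 1 := by
  classical
  have hper := card_filter_Ico_of_periodic hq 1 (N / q + 1) (fun x : ℕ => (x : ZMod q) = a)
    (fun t => by rw [ZMod.natCast_mod])
  have hone : #((range q).filter fun x : ℕ => (x : ZMod q) = a) ≤ 1 := by
    refine Finset.card_le_one.2 fun x hx y hy => ?_
    rw [Finset.mem_filter, Finset.mem_range] at hx hy
    have hx' := congrArg ZMod.val hx.2
    have hy' := congrArg ZMod.val hy.2
    rw [ZMod.val_cast_of_lt hx.1] at hx'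
    rw [ZMod.val_cast_of_lt hy.1] at hy'
    rw [hx', hy']
  have hsub : (Icc 1 N).filter (fun x : ℕ => (x : ZMod q) = a) ⊆
      (Ico 1 (1 + (N / q + 1) * q)).filter (fun x : ℕ => (x : ZMod q) = a) := by
    apply Finset.filter_subset_filter
    intro x hx
    rw [Finset.mem_Icc] at hx
    rw [Finset.mem_Ico]
    have := Nat.lt_div_mul_add hq (a := N)
    constructor
    · exact hx.1
    · nlinarith [hx.2]
  calc #((Icc 1 N).filter fun x : ℕ => (x : ZMod q) = a)
      ≤ #((Ico 1 (1 + (N / q + 1) * q)).filter (fun x : ℕ => (x : ZMod q) = a)) :=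
        Finset.card_le_card hsub
    _ = (N / q + 1) * #((range q).filter fun x : ℕ => (x : ZMod q) = a) := hper
    _ ≤ (N / q + 1) * 1 := Nat.mul_le_mul_left _ hone
    _ = N / q + 1 := mul_one _

/-- `θ(N; q, a) ≤ (N/q + 1) log N` (`q ≥ 1`): at most `N/q + 1` terms, each `≤ log N`. [folklore] -/
theorem thetaMod_le {q : ℕ} (hq : 0 < q) (a : ZMod q) (N : ℕ) :
    thetaMod N q a ≤ ((N : ℝ) / q + 1) * Real.log N := by
  have hlog : 0 ≤ Real.log N := Real.log_natCast_nonneg N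
  have hc := card_filter_Icc_natCast_eq_le hq a N
  have hc' : (#((Icc 1 N).filter fun x : ℕ => (x : ZMod q) = a) : ℝ) ≤ (N : ℝ) / q + 1 := by
    calc (#((Icc 1 N).filter fun x : ℕ => (x : ZMod q) = a) : ℝ) ≤ ((N / q + 1 : ℕ) : ℝ) := by
          exact_mod_cast hc
      _ = ((N / q : ℕ) : ℝ) + 1 := by push_cast; ring
      _ ≤ (N : ℝ) / q + 1 := by linarith [Nat.cast_div_le (m := N) (n := q) (α := ℝ)]
  calc thetaMod N q a ≤ #((Icc 1 N).filter fun x : ℕ => (x : ZMod q) = a) * Real.log N :=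
        sum_theta_le_card_mul_log (fun x hx => (Finset.mem_Icc.1 (Finset.mem_filter.1 hx).1).2)
    _ ≤ ((N : ℝ) / q + 1) * Real.log N := mul_le_mul_of_nonneg_right hc' hlog

/-- For squarefree `q`: `φ(q) = ∏_{p ∣ q} (p − 1) ≥ ∏_{p ∣ q} p/2`, i.e. `q ≤ d_2(q) φ(q)`. [folklore] -/
theorem le_dGen_two_mul_totient {q : ℕ} (hq : Squarefree q) :
    (q : ℝ) ≤ dGen 2 q * Nat.totient q := by
  have hq0 := hq.ne_zero
  have hprod : ∏ p ∈ q.primeFactors, p = q := Nat.prod_primeFactors_of_squarefree hq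
  have hφ : Nat.totient q = ∏ p ∈ q.primeFactors, (p - 1) := by
    have h := Nat.totient_mul_prod_primeFactors q
    rw [hprod, mul_comm q] at h
    exact Nat.eq_of_mul_eq_mul_right (Nat.pos_of_ne_zero hq0) h
  have hω : ω q = q.primeFactors.card := by
    rw [ArithmeticFunction.cardDistinctFactors_apply, Nat.primeFactors, List.card_toFinset]
  rw [dGen, hω, hφ, ← Finset.prod_const]
  push_cast
  rw [← Finset.prod_mul_distrib]
  conv_lhs => rw [← hprod]
  push_cast
  refine Finset.prod_le_prod (fun p _ => Nat.cast_nonneg p) fun p hp => ?_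
  have hp := (Nat.prime_of_mem_primeFactors hp).two_le
  have : ((p - 1 : ℕ) : ℝ) = (p : ℝ) - 1 := by
    rw [Nat.cast_sub (by omega)]; simp
  rw [this]
  have hp' : (2 : ℝ) ≤ p := by exact_mod_cast hp
  linarith

/-- The trivial estimate "`E'(N, q) ≤ (2N/q) log N` for `q ≤ N`" (GPY p. 19) in the form
`E'(N, q) ≤ 2N(1 + log N) d_2(q)/q` for squarefree `1 ≤ q ≤ N`
(`θ(N; q, a) ≤ (N/q + 1) log N ≤ (2N/q) log N` and `N/φ(q) ≤ N d_2(q)/q`).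
[cite: GoldstonPintzYildirim2009, Section 9 eq. 9.13] -/
theorem thetaErr_le_trivial {q N : ℕ} (hq : Squarefree q) (hqN : q ≤ N) :
    thetaErr N q ≤ 2 * N * (1 + Real.log N) * dGen 2 q / q := by
  have hq0 : 0 < q := Nat.pos_of_ne_zero hq.ne_zero
  have hq0' : (0 : ℝ) < q := by exact_mod_cast hq0
  have hN : (q : ℝ) ≤ N := by exact_mod_cast hqN
  have hlog : 0 ≤ Real.log N := Real.log_natCast_nonneg N
  have hd1 : 1 ≤ dGen 2 q := one_le_dGen (by norm_num) q
  have hφ := le_dGen_two_mul_totient hq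
  have hφ0 : (0 : ℝ) < Nat.totient q := by exact_mod_cast Nat.totient_pos.2 hq0
  have hNq : 1 ≤ (N : ℝ) / q := (one_le_div hq0').2 hN
  have hNq0 : 0 ≤ (N : ℝ) / q := by positivity
  apply thetaErr_le (by positivity)
  intro a
  have h1 := thetaMod_le hq0 (a : ZMod q) N
  have h0 := thetaMod_nonneg N q (a : ZMod q)
  have h2 : (N : ℝ) / Nat.totient q ≤ N * dGen 2 q / q := by
    rw [div_le_div_iff₀ hφ0 hq0']
    calc (N : ℝ) * q ≤ N * (dGen 2 q * Nat.totient q) :=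
          mul_le_mul_of_nonneg_left hφ (Nat.cast_nonneg N)
      _ = N * dGen 2 q * Nat.totient q := by ring
  have h3 : 0 ≤ (N : ℝ) / Nat.totient q := by positivity
  have h4 : (N : ℝ) * dGen 2 q / q ≤ 2 * N * (1 + Real.log N) * dGen 2 q / q := by
    have h5 : (N : ℝ) * dGen 2 q / q * 1 ≤ N * dGen 2 q / q * (2 * (1 + Real.log N)) :=
      mul_le_mul_of_nonneg_left (by linarith) (by positivity)
    calc (N : ℝ) * dGen 2 q / q = N * dGen 2 q / q * 1 := (mul_one _).symm
      _ ≤ N * dGen 2 q / q * (2 * (1 + Real.log N)) := h5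
      _ = _ := by ring
  have h6 : ((N : ℝ) / q + 1) * Real.log N ≤ 2 * N * (1 + Real.log N) * dGen 2 q / q := by
    calc ((N : ℝ) / q + 1) * Real.log N ≤ ((N : ℝ) / q + N / q) * Real.log N :=
          mul_le_mul_of_nonneg_right (by linarith) hlog
      _ = 2 * (N / q) * Real.log N := by ring
      _ ≤ 2 * (N / q) * (1 + Real.log N) := mul_le_mul_of_nonneg_left (by linarith) (by positivity)
      _ = 2 * (N / q) * (1 + Real.log N) * 1 := (mul_one _).symm
      _ ≤ 2 * (N / q) * (1 + Real.log N) * dGen 2 q :=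
          mul_le_mul_of_nonneg_left hd1 (by positivity)
      _ = _ := by ring
  rw [abs_le]
  constructor <;> linarith

/-- `∑♭_{q ≤ x} d_m(q)² E'(N, q) ≤ 2N(1 + log N) D'(x, 2m²)` for `x ≤ N`, `m ≥ 0` (the trivial
estimate and (5.9): `d_m(q)² d_2(q) = d_{2m²}(q)`; GPY's "`√((log N)^{9k²}) √(2N log N)`" factor
before Lemma 2). [cite: GoldstonPintzYildirim2009, Section 9 eq. 9.13] -/
theorem sum_dGen_sq_mul_thetaErr_le {x : ℝ} {N : ℕ} (hx : x ≤ N) {m : ℝ} (hm : 0 ≤ m) :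
    ∑ q ∈ squarefreeLE x, dGen m q ^ 2 * thetaErr N q ≤
      2 * N * (1 + Real.log N) * sumDGenDiv x (2 * m ^ 2) := by
  rw [sumDGenDiv, Finset.mul_sum]
  refine Finset.sum_le_sum fun q hq => ?_
  obtain ⟨⟨hq1, hqx⟩, hsq⟩ := mem_squarefreeLE.1 hq
  have hx1 : 1 ≤ x := Nat.floor_pos.1 (by omega)
  have hqN : q ≤ N := by
    have h : (q : ℝ) ≤ N :=
      (show (q : ℝ) ≤ ⌊x⌋₊ by exact_mod_cast hqx).trans ((Nat.floor_le (by linarith)).trans hx)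
    exact_mod_cast h
  have hE := thetaErr_le_trivial hsq hqN
  have hd0 : 0 ≤ dGen m q ^ 2 := pow_nonneg (dGen_nonneg hm q) 2
  have hmul : dGen (2 * m ^ 2) q = dGen m q ^ 2 * dGen 2 q := by
    rw [sq (dGen m q), dGen_mul, dGen_mul]
    congr 1
    ring
  calc dGen m q ^ 2 * thetaErr N q ≤ dGen m q ^ 2 * (2 * N * (1 + Real.log N) * dGen 2 q / q) :=
        mul_le_mul_of_nonneg_left hE hd0
    _ = 2 * N * (1 + Real.log N) * (dGen (2 * m ^ 2) q / q) := by rw [hmul]; ring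

/-! ### The Bombieri–Vinogradov theorem for `θ` at the point `N` -/

/-- `Λ(n) − θ(n) ≥ 0` (equality at primes). [folklore] -/
theorem theta_le_vonMangoldt (n : ℕ) : theta n ≤ ArithmeticFunction.vonMangoldt n := by
  by_cases hp : n.Prime
  · rw [theta, if_pos hp, ArithmeticFunction.vonMangoldt_apply_prime hp]
  · rw [theta_of_not_prime hp]
    exact ArithmeticFunction.vonMangoldt_nonneg

/-- `ψ(N; q, a) − θ(N; q, a) ∈ [0, ψ(N) − ϑ(N)]`: the two residue-class sums differ by the prime
powers `p^m ≤ N`, `m ≥ 2`, in the class. [folklore] -/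
theorem thetaMod_le_chebyshevPsiMod_and (N q : ℕ) (a : ZMod q) :
    thetaMod N q a ≤ ParityWave0.chebyshevPsiMod q a N ∧
      ParityWave0.chebyshevPsiMod q a N - thetaMod N q a ≤ Chebyshev.psi N - Chebyshev.theta N := by
  classical
  have hψ : ParityWave0.chebyshevPsiMod q a N =
      ∑ n ∈ Icc 1 N, if (n : ZMod q) = a then ArithmeticFunction.vonMangoldt n else 0 := by
    rw [ParityWave0.chebyshevPsiMod, Nat.floor_natCast, Finset.range_eq_Ico,
      Finset.sum_eq_sum_Ico_succ_bot (by omega : 0 < N + 1), Finset.Ico_add_one_right_eq_Icc,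
      zero_add]
    simp only [ArithmeticFunction.vonMangoldt.residueClass, Set.indicator_apply, Set.mem_setOf_eq,
      Nat.cast_zero, ArithmeticFunction.map_zero, ite_self, zero_add]
  have hθ : thetaMod N q a = ∑ n ∈ Icc 1 N, if (n : ZMod q) = a then theta n else 0 := by
    rw [thetaMod, Finset.sum_filter]
  have hIcc : Finset.Icc 1 N = Finset.Ioc 0 N := Finset.Icc_add_one_left_eq_Ioc 0 N
  have hpsi : Chebyshev.psi N = ∑ n ∈ Icc 1 N, ArithmeticFunction.vonMangoldt n := by
    rw [Chebyshev.psi, Nat.floor_natCast, hIcc]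
  have htheta : Chebyshev.theta N = ∑ n ∈ Icc 1 N, theta n := by
    rw [Chebyshev.theta, Nat.floor_natCast, hIcc, Finset.sum_filter]
    rfl
  rw [hψ, hθ, hpsi, htheta, ← Finset.sum_sub_distrib, ← Finset.sum_sub_distrib]
  constructor
  · refine Finset.sum_le_sum fun n _ => ?_
    split_ifs
    · exact theta_le_vonMangoldt n
    · exact le_rfl
  · refine Finset.sum_le_sum fun n _ => ?_
    have := theta_le_vonMangoldt n
    split_ifs <;> linarith

/-- `E'(N, q) ≤ max_{(a,q)=1} |ψ(N; q, a) − N/φ(q)| + 2√N log N` for `N ≥ 1`: passage from the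
tree's `ψ`-weighted Bombieri–Vinogradov summand to the `θ`-weighted one of GPY (1.2)–(1.3), by
Chebyshev's `ψ(N) − ϑ(N) ≤ 2√N log N` (Mathlib). [folklore] -/
theorem thetaErr_le_psiErr_add {N : ℕ} (hN : 1 ≤ N) (q : ℕ) :
    thetaErr N q ≤ (⨆ a : (ZMod q)ˣ, |ParityWave0.chebyshevPsiMod q (a : ZMod q) N -
        (N : ℝ) / (Nat.totient q : ℝ)|) + 2 * Real.sqrt N * Real.log N := by
  have hcheb := Chebyshev.psi_sub_theta_le (show (1 : ℝ) ≤ N by exact_mod_cast hN)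
  have hsup0 : 0 ≤ ⨆ a : (ZMod q)ˣ, |ParityWave0.chebyshevPsiMod q (a : ZMod q) N -
      (N : ℝ) / (Nat.totient q : ℝ)| := Real.iSup_nonneg fun _ => abs_nonneg _
  have hextra : 0 ≤ 2 * Real.sqrt N * Real.log N := by
    have := Real.log_natCast_nonneg N
    positivity
  apply thetaErr_le (by positivity)
  intro a
  have hle := le_ciSup (f := fun a : (ZMod q)ˣ => |ParityWave0.chebyshevPsiMod q (a : ZMod q) N -
      (N : ℝ) / (Nat.totient q : ℝ)|) (Set.finite_range _).bddAbove a
  obtain ⟨h1, h2⟩ := thetaMod_le_chebyshevPsiMod_and N q (a : ZMod q)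
  have habs : |thetaMod N q (a : ZMod q) - (N : ℝ) / (Nat.totient q : ℝ)| ≤
      |ParityWave0.chebyshevPsiMod q (a : ZMod q) N - (N : ℝ) / (Nat.totient q : ℝ)| +
        (ParityWave0.chebyshevPsiMod q (a : ZMod q) N - thetaMod N q (a : ZMod q)) := by
    rw [abs_le]
    constructor
    · have := neg_abs_le (ParityWave0.chebyshevPsiMod q (a : ZMod q) N - (N : ℝ) / (Nat.totient q : ℝ))
      linarith
    · have := le_abs_self (ParityWave0.chebyshevPsiMod q (a : ZMod q) N - (N : ℝ) / (Nat.totient q : ℝ))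
      linarith
  linarith

/-- **The Bombieri–Vinogradov theorem in the `θ`-form (1.3) at the point `x = N`**: for every `A`
there are `B > 0`, `C` and `N₀` with
`∑_{q ≤ N^{1/2}/(log N)^B} max_{(a,q)=1} |θ(N; q, a) − N/φ(q)| ≤ C N/(log N)^A` for `N ≥ N₀`.
From the tree's `Literature.NumberTheory.Sieve.bombieri_vinogradov_holds` (parity.S27, `ψ`-form with
`max_{y ≤ x}`; Bombieri 1965) and `thetaErr_le_psiErr_add` (the prime powers cost
`≤ Q · 2√N log N ≤ 2N (log N)^{1−B}`, absorbed by taking `B ≥ A + 1`).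
[cite: GoldstonPintzYildirim2009, Section 1 eq. 1.3] -/
theorem bombieriVinogradov_thetaErr (A : ℝ) :
    ∃ B C : ℝ, 0 < B ∧ ∃ N₀ : ℕ, ∀ N : ℕ, N₀ ≤ N →
      ∑ q ∈ Icc 1 ⌊(N : ℝ) ^ (1 / 2 : ℝ) / Real.log N ^ B⌋₊, thetaErr N q ≤
        C * N / Real.log N ^ A := by
  obtain ⟨B, C, hBC⟩ := Literature.NumberTheory.Sieve.bombieri_vinogradov_holds A
  obtain ⟨x₀, hx₀⟩ := Filter.eventually_atTop.1 hBC
  set B' : ℝ := max (max B 1) (A + 1) with hB'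
  have hB'B : B ≤ B' := (le_max_left _ _).trans (le_max_left _ _)
  have hB'1 : 1 ≤ B' := (le_max_right _ _).trans (le_max_left _ _)
  have hB'A : A + 1 ≤ B' := le_max_right _ _
  refine ⟨B', C + 2, by linarith, max ⌈x₀⌉₊ 3, fun N hN => ?_⟩
  have hN3 : 3 ≤ N := le_of_max_le_right hN
  have hNx : x₀ ≤ (N : ℝ) := (Nat.le_ceil x₀).trans (by exact_mod_cast le_of_max_le_left hN)
  have hN1 : (1 : ℝ) ≤ N := by exact_mod_cast (by omega : 1 ≤ N)
  have hN0 : (0 : ℝ) < N := by linarith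
  have hlog1 : 1 ≤ Real.log N := by
    rw [Real.le_log_iff_exp_le hN0]
    have : Real.exp 1 < 3 := Real.exp_one_lt_d9.trans (by norm_num)
    have h3 : (3 : ℝ) ≤ N := by exact_mod_cast hN3
    linarith
  have hlog0 : 0 < Real.log N := by linarith
  -- the tree's BV at `x = N`, `y_q = N`
  have hBV := hx₀ (N : ℝ) hNx (fun _ => (N : ℝ)) (fun _ => ⟨hN1, le_rfl⟩)
  set Q := ⌊(N : ℝ) ^ (1 / 2 : ℝ) / Real.log N ^ B⌋₊ with hQ
  set Q' := ⌊(N : ℝ) ^ (1 / 2 : ℝ) / Real.log N ^ B'⌋₊ with hQ'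
  have hsqrt : (N : ℝ) ^ (1 / 2 : ℝ) = Real.sqrt N := (Real.sqrt_eq_rpow (N : ℝ)).symm
  have hpowB : Real.log N ^ B ≤ Real.log N ^ B' := Real.rpow_le_rpow_of_exponent_le hlog1 hB'B
  have hpowB0 : 0 < Real.log N ^ B := Real.rpow_pos_of_pos hlog0 B
  have hQQ : Q' ≤ Q := by
    apply Nat.floor_le_floor
    exact div_le_div_of_nonneg_left (Real.rpow_nonneg hN0.le _) hpowB0 hpowB
  have hQ'le : (Q' : ℝ) ≤ (N : ℝ) ^ (1 / 2 : ℝ) / Real.log N ^ B' :=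
    Nat.floor_le (div_nonneg (Real.rpow_nonneg hN0.le _) (Real.rpow_nonneg hlog0.le _))
  -- termwise passage θ ← ψ
  have hterm : ∀ q ∈ Icc 1 Q', thetaErr N q ≤
      (⨆ a : (ZMod q)ˣ, |ParityWave0.chebyshevPsiMod q (a : ZMod q) N -
        (N : ℝ) / (Nat.totient q : ℝ)|) + 2 * Real.sqrt N * Real.log N :=
    fun q _ => thetaErr_le_psiErr_add (by omega) q
  have hpsi0 : ∀ q ∈ Icc 1 Q, 0 ≤ ⨆ a : (ZMod q)ˣ, |ParityWave0.chebyshevPsiMod q (a : ZMod q) N -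
      (N : ℝ) / (Nat.totient q : ℝ)| := fun q _ => Real.iSup_nonneg fun _ => abs_nonneg _
  calc ∑ q ∈ Icc 1 Q', thetaErr N q
      ≤ ∑ q ∈ Icc 1 Q', ((⨆ a : (ZMod q)ˣ, |ParityWave0.chebyshevPsiMod q (a : ZMod q) N -
          (N : ℝ) / (Nat.totient q : ℝ)|) + 2 * Real.sqrt N * Real.log N) := Finset.sum_le_sum hterm
    _ = ∑ q ∈ Icc 1 Q', (⨆ a : (ZMod q)ˣ, |ParityWave0.chebyshevPsiMod q (a : ZMod q) N -
          (N : ℝ) / (Nat.totient q : ℝ)|) + Q' * (2 * Real.sqrt N * Real.log N) := by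
        rw [Finset.sum_add_distrib, Finset.sum_const, nsmul_eq_mul, Nat.card_Icc, Nat.add_sub_cancel]
    _ ≤ ∑ q ∈ Icc 1 Q, (⨆ a : (ZMod q)ˣ, |ParityWave0.chebyshevPsiMod q (a : ZMod q) N -
          (N : ℝ) / (Nat.totient q : ℝ)|) +
          ((N : ℝ) ^ (1 / 2 : ℝ) / Real.log N ^ B') * (2 * Real.sqrt N * Real.log N) := by
        refine add_le_add ?_ (mul_le_mul_of_nonneg_right hQ'le (by positivity))
        exact Finset.sum_le_sum_of_subset_of_nonneg (Finset.Icc_subset_Icc_right hQQ)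
          (fun q hq _ => hpsi0 q hq)
    _ ≤ C * N / Real.log N ^ A + 2 * N / Real.log N ^ A := by
        refine add_le_add hBV ?_
        rw [hsqrt]
        have hNN : Real.sqrt N * Real.sqrt N = N := Real.mul_self_sqrt hN0.le
        have hexp : Real.log N / Real.log N ^ B' ≤ 1 / Real.log N ^ A := by
          rw [div_le_div_iff₀ (Real.rpow_pos_of_pos hlog0 B') (Real.rpow_pos_of_pos hlog0 A), one_mul]
          calc Real.log N * Real.log N ^ A = Real.log N ^ (A + 1) := by
                rw [Real.rpow_add hlog0, Real.rpow_one, mul_comm]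
            _ ≤ Real.log N ^ B' := Real.rpow_le_rpow_of_exponent_le hlog1 hB'A
        calc Real.sqrt N / Real.log N ^ B' * (2 * Real.sqrt N * Real.log N)
            = 2 * (Real.sqrt N * Real.sqrt N) * (Real.log N / Real.log N ^ B') := by ring
          _ = 2 * N * (Real.log N / Real.log N ^ B') := by rw [hNN]
          _ ≤ 2 * N * (1 / Real.log N ^ A) := mul_le_mul_of_nonneg_left hexp (by positivity)
          _ = 2 * N / Real.log N ^ A := by ring
    _ = (C + 2) * N / Real.log N ^ A := by ring

/-! ### (9.13): Cauchy–Schwarz, Lemma 2 and Bombieri–Vinogradov -/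

/-- Cauchy–Schwarz as used in (9.13): for `E ≥ 0`, `(∑ a_q E_q)² ≤ (∑ a_q² E_q)(∑ E_q)`.
[folklore] -/
theorem sq_sum_mul_le_of_nonneg {ι : Type*} (s : Finset ι) {a E : ι → ℝ}
    (hE : ∀ i ∈ s, 0 ≤ E i) :
    (∑ i ∈ s, a i * E i) ^ 2 ≤ (∑ i ∈ s, a i ^ 2 * E i) * ∑ i ∈ s, E i := by
  have h := Finset.sum_mul_sq_le_sq_mul_sq s (fun i => a i * Real.sqrt (E i))
    (fun i => Real.sqrt (E i))
  have h1 : ∀ i ∈ s, a i * Real.sqrt (E i) * Real.sqrt (E i) = a i * E i := fun i hi => by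
    rw [mul_assoc, Real.mul_self_sqrt (hE i hi)]
  have h2 : ∀ i ∈ s, (a i * Real.sqrt (E i)) ^ 2 = a i ^ 2 * E i := fun i hi => by
    rw [mul_pow, Real.sq_sqrt (hE i hi)]
  have h3 : ∀ i ∈ s, Real.sqrt (E i) ^ 2 = E i := fun i hi => Real.sq_sqrt (hE i hi)
  rw [Finset.sum_congr rfl h1, Finset.sum_congr rfl h2, Finset.sum_congr rfl h3] at h
  exact h

/-- `log N ≥ 1` for `N ≥ 3`. [folklore] -/
theorem one_le_log_of_three_le {N : ℕ} (hN : 3 ≤ N) : 1 ≤ Real.log N := by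
  have hN0 : (0 : ℝ) < N := by exact_mod_cast (by omega : 0 < N)
  rw [Real.le_log_iff_exp_le hN0]
  have : Real.exp 1 < 3 := Real.exp_one_lt_d9.trans (by norm_num)
  have h3 : (3 : ℝ) ≤ N := by exact_mod_cast hN
  linarith

/-- **GPY (9.13)**: given `M`, `A` there are `B = B(A, M) > 0`, `C`, `N₀` such that for
`N ≥ N₀`, `1 ≤ R`, `R² ≤ N^{1/2}/(log N)^B` and `k₁ + k₂ ≤ M`,
`𝓔 = ∑_{d,e ≤ R}♭ nuJoint(d,e) E'(N,[d,e]) ≤ C N/(log N)^A`: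
regroup by `q = [d,e]` (`thetaErrSum_le`), Cauchy–Schwarz between `d_{4M}(q)² E'(N,q)`
(trivial estimate + Lemma 2 (5.11): `≤ 2N(1+log N)(32M²+1+log N)^{32M²+1}`) and `E'(N, q)`
(Bombieri–Vinogradov for `θ` at the exponent `2A + 32M² + 2`). The source's
`√((log N)^{9k²}) √(2N log N) √(∑ E') ≪ N (log N)^{(9k²+1−A)/2}`.
[cite: GoldstonPintzYildirim2009, Section 9 eq. 9.13] -/
theorem thetaErrSum_le_of_BV (M : ℕ) (A : ℝ) :
    ∃ B C : ℝ, 0 < B ∧ ∃ N₀ : ℕ, ∀ (R : ℝ) (N : ℕ) (H₁ H₂ : Finset ℕ),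
      N₀ ≤ N → 1 ≤ R → R ^ 2 ≤ (N : ℝ) ^ (1 / 2 : ℝ) / Real.log N ^ B → #H₁ + #H₂ ≤ M →
      thetaErrSum R H₁ H₂ N ≤ C * N / Real.log N ^ A := by
  set m : ℕ := 32 * M ^ 2 + 1 with hm
  obtain ⟨B, Cθ, hB, N₁, hBV⟩ := bombieriVinogradov_thetaErr (2 * A + m + 1)
  set C₁ : ℝ := max Cθ 1 with hC₁
  have hC₁1 : 1 ≤ C₁ := le_max_right _ _
  have hC₁θ : Cθ ≤ C₁ := le_max_left _ _
  refine ⟨B, 2 * ((m : ℝ) + 1) ^ m * C₁, hB, max N₁ 3, ?_⟩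
  intro R N H₁ H₂ hN hR hR2 hkM
  have hN3 : 3 ≤ N := le_of_max_le_right hN
  have hN1 : (1 : ℝ) ≤ N := by exact_mod_cast (by omega : 1 ≤ N)
  have hN0 : (0 : ℝ) < N := by linarith
  have hlog1 : 1 ≤ Real.log N := one_le_log_of_three_le hN3
  have hlog0 : 0 < Real.log N := by linarith
  set L := Real.log N with hL
  have hm1 : (1 : ℝ) ≤ m := by rw [hm]; exact_mod_cast Nat.le_add_left 1 _
  have hm0 : (0 : ℝ) < m := by linarith
  -- `R² ≤ N^{1/2} ≤ N`
  have hpowB1 : 1 ≤ L ^ B := Real.one_le_rpow hlog1 hB.le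
  have hR2' : R ^ 2 ≤ (N : ℝ) ^ (1 / 2 : ℝ) :=
    hR2.trans (div_le_self (Real.rpow_nonneg hN0.le _) hpowB1)
  have hsqrtN : (N : ℝ) ^ (1 / 2 : ℝ) ≤ N := by
    have h := Real.rpow_le_rpow_of_exponent_le hN1 (show (1 / 2 : ℝ) ≤ 1 by norm_num)
    rwa [Real.rpow_one] at h
  have hR2N : R ^ 2 ≤ N := hR2'.trans hsqrtN
  -- Step 1: regroup, with the uniform weight `d_{4M}`
  set w : ℕ → ℝ := fun q => dGen (4 * (M : ℝ)) q with hw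
  have hkM' : 4 * ((#H₁ : ℝ) + #H₂) ≤ 4 * (M : ℝ) := by
    have h : ((#H₁ + #H₂ : ℕ) : ℝ) ≤ M := by exact_mod_cast hkM
    push_cast at h
    linarith
  have hS : thetaErrSum R H₁ H₂ N ≤ ∑ q ∈ squarefreeLE (R ^ 2), w q * thetaErr N q := by
    refine (thetaErrSum_le hR H₁ H₂ N).trans (Finset.sum_le_sum fun q _ => ?_)
    exact mul_le_mul_of_nonneg_right (dGen_mono (by positivity) hkM' q) (thetaErr_nonneg N q)
  set S := ∑ q ∈ squarefreeLE (R ^ 2), w q * thetaErr N q with hSdef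
  have hS0 : 0 ≤ S :=
    Finset.sum_nonneg fun q _ => mul_nonneg (dGen_nonneg (by positivity) q) (thetaErr_nonneg N q)
  -- Step 2: Cauchy–Schwarz
  have hCS := sq_sum_mul_le_of_nonneg (squarefreeLE (R ^ 2)) (a := w)
    (E := fun q => thetaErr N q) (fun q _ => thetaErr_nonneg N q)
  -- Step 3a: the weighted factor (trivial estimate + Lemma 2)
  have hX₁ := sum_dGen_sq_mul_thetaErr_le (x := R ^ 2) hR2N (show (0 : ℝ) ≤ 4 * (M : ℝ) by positivity)
  have hDiv : sumDGenDiv (R ^ 2) (2 * (4 * (M : ℝ)) ^ 2) ≤ ((m : ℝ) + L) ^ m := by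
    have hmm : 2 * (4 * (M : ℝ)) ^ 2 ≤ (m : ℝ) := by rw [hm]; push_cast; nlinarith
    have hmono := sumDGenDiv_mono (show (0 : ℝ) ≤ 2 * (4 * (M : ℝ)) ^ 2 by positivity) hmm (R ^ 2)
    have hle := sumDGenDiv_le hm0 (show (1 : ℝ) ≤ R ^ 2 by nlinarith)
    rw [Nat.ceil_natCast] at hle
    have hlogR : Real.log (R ^ 2) ≤ L := Real.log_le_log (by positivity) hR2N
    have hlogR0 : 0 ≤ Real.log (R ^ 2) := Real.log_nonneg (by nlinarith)
    calc sumDGenDiv (R ^ 2) (2 * (4 * (M : ℝ)) ^ 2) ≤ sumDGenDiv (R ^ 2) m := hmono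
      _ ≤ ((m : ℝ) + Real.log (R ^ 2)) ^ m := hle
      _ ≤ ((m : ℝ) + L) ^ m := pow_le_pow_left₀ (by positivity) (by linarith) m
  have hX : ∑ q ∈ squarefreeLE (R ^ 2), w q ^ 2 * thetaErr N q ≤
      4 * ((m : ℝ) + 1) ^ m * N * (L ^ m * L) := by
    have h1L : 1 + L ≤ 2 * L := by linarith
    have hmL : (m : ℝ) + L ≤ ((m : ℝ) + 1) * L := by nlinarith
    have hmL' : ((m : ℝ) + L) ^ m ≤ (((m : ℝ) + 1) * L) ^ m :=
      pow_le_pow_left₀ (by positivity) hmL m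
    calc ∑ q ∈ squarefreeLE (R ^ 2), w q ^ 2 * thetaErr N q
        ≤ 2 * N * (1 + L) * sumDGenDiv (R ^ 2) (2 * (4 * (M : ℝ)) ^ 2) := hX₁
      _ ≤ 2 * N * (1 + L) * ((m : ℝ) + L) ^ m := mul_le_mul_of_nonneg_left hDiv (by positivity)
      _ ≤ 2 * N * (2 * L) * (((m : ℝ) + 1) * L) ^ m := by
          apply mul_le_mul (mul_le_mul_of_nonneg_left h1L (by positivity)) hmL'
            (by positivity) (by positivity)
      _ = 4 * ((m : ℝ) + 1) ^ m * N * (L ^ m * L) := by rw [mul_pow]; ring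
  -- Step 3b: the `E'` factor (Bombieri–Vinogradov for `θ`)
  have hLsplit : L ^ (2 * A + m + 1) = (L ^ A) ^ 2 * (L ^ m * L) := by
    rw [show (2 * A + m + 1 : ℝ) = (A + A) + ((m : ℝ) + 1) by ring, Real.rpow_add hlog0,
      Real.rpow_add hlog0, Real.rpow_add hlog0, Real.rpow_natCast, Real.rpow_one, sq]
  have hLA0 : 0 < L ^ A := Real.rpow_pos_of_pos hlog0 A
  have hLm0 : 0 < L ^ m * L := by positivity
  have hY : ∑ q ∈ squarefreeLE (R ^ 2), thetaErr N q ≤ C₁ * N / ((L ^ A) ^ 2 * (L ^ m * L)) := by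
    calc ∑ q ∈ squarefreeLE (R ^ 2), thetaErr N q
        ≤ ∑ q ∈ Icc 1 ⌊(N : ℝ) ^ (1 / 2 : ℝ) / L ^ B⌋₊, thetaErr N q := by
          apply Finset.sum_le_sum_of_subset_of_nonneg _ (fun q _ _ => thetaErr_nonneg N q)
          intro q hq
          rw [mem_squarefreeLE] at hq
          rw [Finset.mem_Icc]
          exact ⟨hq.1.1, hq.1.2.trans (Nat.floor_le_floor hR2)⟩
      _ ≤ Cθ * N / L ^ (2 * A + m + 1) := hBV N (le_of_max_le_left hN)
      _ ≤ C₁ * N / L ^ (2 * A + m + 1) :=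
          div_le_div_of_nonneg_right (mul_le_mul_of_nonneg_right hC₁θ hN0.le)
            (Real.rpow_nonneg hlog0.le _)
      _ = C₁ * N / ((L ^ A) ^ 2 * (L ^ m * L)) := by rw [hLsplit]
  -- Step 4: combine
  have hY0 : 0 ≤ ∑ q ∈ squarefreeLE (R ^ 2), thetaErr N q :=
    Finset.sum_nonneg fun q _ => thetaErr_nonneg N q
  have hP : S ^ 2 ≤ (4 * ((m : ℝ) + 1) ^ m * N * (L ^ m * L)) *
      (C₁ * N / ((L ^ A) ^ 2 * (L ^ m * L))) :=
    hCS.trans (mul_le_mul hX hY hY0 (by positivity))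
  have hPeq : (4 * ((m : ℝ) + 1) ^ m * N * (L ^ m * L)) * (C₁ * N / ((L ^ A) ^ 2 * (L ^ m * L))) =
      (4 * ((m : ℝ) + 1) ^ m * C₁ * N ^ 2 / (L ^ A) ^ 2) := by
    field_simp
  set T : ℝ := 2 * ((m : ℝ) + 1) ^ m * C₁ * N / L ^ A with hT
  have hT0 : 0 ≤ T := by positivity
  have hTsq : T ^ 2 = (4 * ((m : ℝ) + 1) ^ m * C₁ * N ^ 2 / (L ^ A) ^ 2) * (((m : ℝ) + 1) ^ m * C₁) := by
    rw [hT]; field_simp; ring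
  have hge1 : 1 ≤ ((m : ℝ) + 1) ^ m * C₁ := one_le_mul_of_one_le_of_one_le (one_le_pow₀ (by linarith)) hC₁1
  have hS2 : S ^ 2 ≤ T ^ 2 := by
    rw [hTsq]
    calc S ^ 2 ≤ 4 * ((m : ℝ) + 1) ^ m * C₁ * N ^ 2 / (L ^ A) ^ 2 := by rw [← hPeq]; exact hP
      _ = (4 * ((m : ℝ) + 1) ^ m * C₁ * N ^ 2 / (L ^ A) ^ 2) * 1 := (mul_one _).symm
      _ ≤ _ := mul_le_mul_of_nonneg_left hge1 (by positivity)
  have hST : S ≤ T := (pow_le_pow_iff_left₀ hS0 hT0 two_ne_zero).1 hS2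
  calc thetaErrSum R H₁ H₂ N ≤ S := hS
    _ ≤ T := hST
    _ = 2 * ((m : ℝ) + 1) ^ m * C₁ * N / L ^ A := hT

/-! ### (9.14): the reduction of Proposition 2 to its main term -/

/-- `D*(x, m) = ∑♭_{q ≤ x} d_m(q)` is monotone in `m ≥ 0`. [folklore] -/
theorem sumDGen_mono {m m' : ℝ} (hm : 0 ≤ m) (h : m ≤ m') (x : ℝ) : sumDGen x m ≤ sumDGen x m' :=
  Finset.sum_le_sum fun q _ => dGen_mono hm h q

/-- **GPY (9.14)**: "given any positive `A` and `M` there is a positive constant `B = B(A, M)` so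
that for `R ≪ N^{1/4}/(log N)^B` and `h ≤ R`,
`S̃_R(N; H₁, H₂, ℓ₁, ℓ₂, h₀) = N 𝒯̃_R(H₁, H₂, ℓ₁, ℓ₂, h₀) + O_M(N/(log N)^A)`."
Rendered with explicit thresholds: for all `M`, `A` there are `B > 0`, `C`, `N₀` such that for
`N ≥ N₀`, `1 ≤ R ≤ N^{1/4}/(log N)^B`, `h₀ ≤ R` (the source has `1 ≤ h₀ ≤ h ≤ R`), `H₁, H₂` not both
empty and `k₁ + k₂ + ℓ₁ + ℓ₂ ≤ M`, `|S̃_R − N 𝒯̃_R| ≤ C N/(log N)^A`. Assembled from the first line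
of (9.12) (`abs_sumTheta_sub_mainTRTheta_le`), (9.13) (`thetaErrSum_le_of_BV`, at the exponent
`A + M` to absorb `(log R)^M`) and, for the term `O(hR²(3 log N)^{M+3k+1})`, Lemma 2 (5.12) with
`h₀ R² ≤ N^{3/4}`. No condition `Hᵢ ⊆ [0, h]` is needed at this stage.
[cite: GoldstonPintzYildirim2009, Section 9 eq. 9.14] -/
theorem abs_sumTheta_sub_mainTRTheta_le_of_BV (M : ℕ) (A : ℝ) :
    ∃ B C : ℝ, 0 < B ∧ ∃ N₀ : ℕ, ∀ (R : ℝ) (N h₀ : ℕ) (H₁ H₂ : Finset ℕ) (ℓ₁ ℓ₂ : ℕ),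
      N₀ ≤ N → 1 ≤ R → R ≤ (N : ℝ) ^ (1 / 4 : ℝ) / Real.log N ^ B → (h₀ : ℝ) ≤ R →
      (H₁.Nonempty ∨ H₂.Nonempty) → #H₁ + #H₂ + ℓ₁ + ℓ₂ ≤ M →
      |∑ n ∈ Icc 1 N, lambdaR R H₁ ℓ₁ n * lambdaR R H₂ ℓ₂ n * theta (n + h₀) -
          N * mainTRTheta R H₁ H₂ ℓ₁ ℓ₂ h₀| ≤ C * N / Real.log N ^ A := by
  obtain ⟨B₇, C₇, hB₇, N₇, h₇⟩ := thetaErrSum_le_of_BV M (A + M)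
  have hev : ∀ᶠ x : ℝ in Filter.atTop, Real.log x ^ (3 * (M : ℝ) + 4 + A) ≤ x ^ (1 / 4 : ℝ) ∧
      4 * ((M : ℝ) + 2) ^ (2 * M + 2) ≤ Real.log x :=
    (eventually_log_rpow_le_rpow (by norm_num : (0 : ℝ) < 1 / 4) _).and
      (Real.tendsto_log_atTop.eventually_ge_atTop _)
  obtain ⟨N₈, hN₈⟩ := Filter.eventually_atTop.1 (tendsto_natCast_atTop_atTop.eventually hev)
  refine ⟨B₇ / 2, C₇ + 1, by positivity, max N₇ (max N₈ 3), ?_⟩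
  intro R N h₀ H₁ H₂ ℓ₁ ℓ₂ hN hR hRle hh₀ hne hM
  have hN₇ : N₇ ≤ N := le_of_max_le_left hN
  obtain ⟨hev1, hev2⟩ := hN₈ N (le_of_max_le_left (le_of_max_le_right hN))
  have hN3 : 3 ≤ N := le_of_max_le_right (le_of_max_le_right hN)
  have hN1 : (1 : ℝ) ≤ N := by exact_mod_cast (by omega : 1 ≤ N)
  have hN0 : (0 : ℝ) < N := by linarith
  have hlog1 : 1 ≤ Real.log N := one_le_log_of_three_le hN3
  have hlog0 : 0 < Real.log N := by linarith
  set L := Real.log N with hL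
  have hLA0 : 0 < L ^ A := Real.rpow_pos_of_pos hlog0 A
  -- ranges: `R ≤ N^{1/4}`, `R² ≤ N^{1/2}/L^{B₇}`, `R³ ≤ N^{3/4}`, `R ≤ N`
  have hLB1 : 1 ≤ L ^ (B₇ / 2) := Real.one_le_rpow hlog1 (by positivity)
  have hN4 : 0 ≤ (N : ℝ) ^ (1 / 4 : ℝ) := Real.rpow_nonneg hN0.le _
  have hR4 : R ≤ (N : ℝ) ^ (1 / 4 : ℝ) := hRle.trans (div_le_self hN4 hLB1)
  have hR0 : 0 ≤ R := by linarith
  have hN42 : ((N : ℝ) ^ (1 / 4 : ℝ)) ^ 2 = (N : ℝ) ^ (1 / 2 : ℝ) := by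
    rw [← Real.rpow_natCast, ← Real.rpow_mul hN0.le]; norm_num
  have hN43 : ((N : ℝ) ^ (1 / 4 : ℝ)) ^ 3 = (N : ℝ) ^ (3 / 4 : ℝ) := by
    rw [← Real.rpow_natCast, ← Real.rpow_mul hN0.le]; norm_num
  have hLB2 : (L ^ (B₇ / 2)) ^ 2 = L ^ B₇ := by
    rw [← Real.rpow_natCast, ← Real.rpow_mul hlog0.le]; norm_num
  have hR2 : R ^ 2 ≤ (N : ℝ) ^ (1 / 2 : ℝ) / L ^ B₇ := by
    have h := pow_le_pow_left₀ hR0 hRle 2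
    rwa [div_pow, hN42, hLB2] at h
  have hR3 : R ^ 3 ≤ (N : ℝ) ^ (3 / 4 : ℝ) := by
    have h := pow_le_pow_left₀ hR0 hR4 3
    rwa [hN43] at h
  have hRN : R ≤ N := by
    refine hR4.trans ?_
    have h := Real.rpow_le_rpow_of_exponent_le hN1 (show (1 / 4 : ℝ) ≤ 1 by norm_num)
    rwa [Real.rpow_one] at h
  have hlogR : Real.log R ≤ L := Real.log_le_log (by linarith) hRN
  have hlogR0 : 0 ≤ Real.log R := Real.log_nonneg hR
  -- the first line of (9.12)
  have hk : 1 ≤ #H₁ + #H₂ := by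
    rcases hne with h | h
    · exact le_add_right (Finset.card_pos.2 h)
    · exact le_add_left (Finset.card_pos.2 h)
  have h912 := abs_sumTheta_sub_mainTRTheta_le hR H₁ H₂ hk ℓ₁ ℓ₂ N h₀
  have hkM : #H₁ + #H₂ ≤ M := by omega
  have hE := h₇ R N H₁ H₂ hN₇ hR hR2 hkM
  have hE0 := thetaErrSum_nonneg R H₁ H₂ N
  have hKM : #H₁ + ℓ₁ + (#H₂ + ℓ₂) ≤ M := by omega
  have hcK : ((#H₁ + ℓ₁).factorial : ℝ)⁻¹ * ((#H₂ + ℓ₂).factorial : ℝ)⁻¹ ≤ 1 := by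
    have h1 : (1 : ℝ) ≤ (#H₁ + ℓ₁).factorial := by exact_mod_cast Nat.factorial_pos _
    have h2 : (1 : ℝ) ≤ (#H₂ + ℓ₂).factorial := by exact_mod_cast Nat.factorial_pos _
    calc ((#H₁ + ℓ₁).factorial : ℝ)⁻¹ * ((#H₂ + ℓ₂).factorial : ℝ)⁻¹ ≤ 1 * 1 :=
          mul_le_mul (inv_le_one_of_one_le₀ h1) (inv_le_one_of_one_le₀ h2) (by positivity)
            zero_le_one
      _ = 1 := mul_one 1
  have hLK : Real.log R ^ (#H₁ + ℓ₁ + (#H₂ + ℓ₂)) ≤ L ^ M := by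
    calc Real.log R ^ (#H₁ + ℓ₁ + (#H₂ + ℓ₂)) ≤ L ^ (#H₁ + ℓ₁ + (#H₂ + ℓ₂)) :=
          pow_le_pow_left₀ hlogR0 hlogR _
      _ ≤ L ^ M := pow_le_pow_right₀ hlog1 hKM
  -- term 1: `L^M 𝓔 ≤ C₇ N / L^A`
  have hLAM : L ^ (A + M) = L ^ A * L ^ M := by rw [Real.rpow_add hlog0, Real.rpow_natCast]
  have hterm1 : L ^ M * thetaErrSum R H₁ H₂ N ≤ C₇ * N / L ^ A := by
    have hLM0 : 0 < L ^ M := by positivity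
    calc L ^ M * thetaErrSum R H₁ H₂ N ≤ L ^ M * (C₇ * N / L ^ (A + M)) :=
          mul_le_mul_of_nonneg_left hE hLM0.le
      _ = C₇ * N / L ^ A := by rw [hLAM]; field_simp
  -- term 2 ingredients: `D*(R, k) ≤ R((M+2)L)^{M+1}`, `2 log R + h₀ log(N+h₀) ≤ 4RL`
  have hsD : sumDGen R ((#H₁ : ℝ) + #H₂) ≤ R * (((M : ℝ) + 2) * L) ^ (M + 1) := by
    have hkM' : (#H₁ : ℝ) + #H₂ ≤ ((M + 1 : ℕ) : ℝ) := by
      have h : ((#H₁ + #H₂ : ℕ) : ℝ) ≤ M := by exact_mod_cast hkM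
      push_cast at h ⊢
      linarith
    have hmono : sumDGen R ((#H₁ : ℝ) + #H₂) ≤ sumDGen R ((M + 1 : ℕ) : ℝ) :=
      sumDGen_mono (by positivity) hkM' R
    have hle := sumDGen_le (m := ((M + 1 : ℕ) : ℝ)) (x := R) (by positivity) hR
    rw [Nat.ceil_natCast] at hle
    have hbase : ((M + 1 : ℕ) : ℝ) + Real.log R ≤ ((M : ℝ) + 2) * L := by
      have h1 : (M : ℝ) + 1 ≤ ((M : ℝ) + 1) * L := le_mul_of_one_le_right (by positivity) hlog1
      push_cast
      linarith
    calc sumDGen R ((#H₁ : ℝ) + #H₂) ≤ sumDGen R ((M + 1 : ℕ) : ℝ) := hmono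
      _ ≤ R * (((M + 1 : ℕ) : ℝ) + Real.log R) ^ (M + 1) := hle
      _ ≤ R * (((M : ℝ) + 2) * L) ^ (M + 1) :=
          mul_le_mul_of_nonneg_left (pow_le_pow_left₀ (by positivity) hbase _) hR0
  have hlogNh : Real.log ((N + h₀ : ℕ) : ℝ) ≤ 2 * L := by
    have hh : (h₀ : ℝ) ≤ N := hh₀.trans hRN
    have h2N : ((N + h₀ : ℕ) : ℝ) ≤ 2 * N := by push_cast; linarith
    have hpos : (0 : ℝ) < ((N + h₀ : ℕ) : ℝ) := by push_cast; linarith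
    calc Real.log ((N + h₀ : ℕ) : ℝ) ≤ Real.log (2 * N) := Real.log_le_log hpos h2N
      _ = Real.log 2 + L := Real.log_mul (by norm_num) hN0.ne'
      _ ≤ 2 * L := by have := Real.log_two_lt_d9; linarith
  have hbr : 2 * Real.log R + h₀ * Real.log ((N + h₀ : ℕ) : ℝ) ≤ 4 * R * L := by
    have h1 : (h₀ : ℝ) * Real.log ((N + h₀ : ℕ) : ℝ) ≤ R * (2 * L) :=
      mul_le_mul hh₀ hlogNh (Real.log_natCast_nonneg _) hR0
    have h2 : L ≤ R * L := le_mul_of_one_le_left hlog0.le hR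
    linarith
  have hbr0 : 0 ≤ 2 * Real.log R + h₀ * Real.log ((N + h₀ : ℕ) : ℝ) :=
    add_nonneg (by linarith) (mul_nonneg (Nat.cast_nonneg h₀) (Real.log_natCast_nonneg (N + h₀)))
  -- term 2: `L^M (4RL) (R((M+2)L)^{M+1})² = 4(M+2)^{2M+2} R³ L^{3M+3} ≤ N/L^A`
  have hsD0 : 0 ≤ sumDGen R ((#H₁ : ℝ) + #H₂) :=
    Finset.sum_nonneg fun q _ => dGen_nonneg (by positivity) q
  have hexp : L * L ^ (3 * M + 3) * L ^ A = L ^ (3 * (M : ℝ) + 4 + A) := by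
    calc L * L ^ (3 * M + 3) * L ^ A = L ^ (1 : ℝ) * L ^ ((3 * M + 3 : ℕ) : ℝ) * L ^ A := by
          rw [Real.rpow_one, Real.rpow_natCast]
      _ = L ^ ((1 : ℝ) + ((3 * M + 3 : ℕ) : ℝ) + A) := by
          rw [Real.rpow_add hlog0, Real.rpow_add hlog0]
      _ = L ^ (3 * (M : ℝ) + 4 + A) := by congr 1; push_cast; ring
  have hterm2 : L ^ M * ((2 * Real.log R + h₀ * Real.log ((N + h₀ : ℕ) : ℝ)) *
      sumDGen R ((#H₁ : ℝ) + #H₂) ^ 2) ≤ N / L ^ A := by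
    have step1 : L ^ M * ((2 * Real.log R + h₀ * Real.log ((N + h₀ : ℕ) : ℝ)) *
        sumDGen R ((#H₁ : ℝ) + #H₂) ^ 2) ≤
        L ^ M * ((4 * R * L) * (R * (((M : ℝ) + 2) * L) ^ (M + 1)) ^ 2) := by
      apply mul_le_mul_of_nonneg_left _ (by positivity)
      exact mul_le_mul hbr (pow_le_pow_left₀ hsD0 hsD 2) (by positivity) (by positivity)
    have step2 : L ^ M * ((4 * R * L) * (R * (((M : ℝ) + 2) * L) ^ (M + 1)) ^ 2) =
        4 * ((M : ℝ) + 2) ^ (2 * M + 2) * R ^ 3 * L ^ (3 * M + 3) := by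
      simp only [mul_pow]
      ring
    have step3 : 4 * ((M : ℝ) + 2) ^ (2 * M + 2) * R ^ 3 * L ^ (3 * M + 3) ≤ N / L ^ A := by
      rw [le_div_iff₀ hLA0]
      have hN34 : 0 ≤ (N : ℝ) ^ (3 / 4 : ℝ) := Real.rpow_nonneg hN0.le _
      calc 4 * ((M : ℝ) + 2) ^ (2 * M + 2) * R ^ 3 * L ^ (3 * M + 3) * L ^ A
          = (4 * ((M : ℝ) + 2) ^ (2 * M + 2) * R ^ 3) * (L ^ (3 * M + 3) * L ^ A) := by ring
        _ ≤ (L * (N : ℝ) ^ (3 / 4 : ℝ)) * (L ^ (3 * M + 3) * L ^ A) :=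
            mul_le_mul_of_nonneg_right (mul_le_mul hev2 hR3 (by positivity) hlog0.le)
              (by positivity)
        _ = L * (N : ℝ) ^ (3 / 4 : ℝ) * L ^ (3 * M + 3) * L ^ A := by ring
        _ = (N : ℝ) ^ (3 / 4 : ℝ) * (L * L ^ (3 * M + 3) * L ^ A) := by ring
        _ = (N : ℝ) ^ (3 / 4 : ℝ) * L ^ (3 * (M : ℝ) + 4 + A) := by rw [hexp]
        _ ≤ (N : ℝ) ^ (3 / 4 : ℝ) * (N : ℝ) ^ (1 / 4 : ℝ) := mul_le_mul_of_nonneg_left hev1 hN34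
        _ = N := by rw [← Real.rpow_add hN0]; norm_num
    calc _ ≤ _ := step1
      _ = _ := step2
      _ ≤ _ := step3
  -- assembly
  have hY0 : 0 ≤ thetaErrSum R H₁ H₂ N +
      (2 * Real.log R + h₀ * Real.log ((N + h₀ : ℕ) : ℝ)) * sumDGen R ((#H₁ : ℝ) + #H₂) ^ 2 :=
    add_nonneg hE0 (mul_nonneg hbr0 (pow_nonneg hsD0 2))
  calc _ ≤ _ := h912
    _ ≤ 1 * (L ^ M * (thetaErrSum R H₁ H₂ N +
          (2 * Real.log R + h₀ * Real.log ((N + h₀ : ℕ) : ℝ)) * sumDGen R ((#H₁ : ℝ) + #H₂) ^ 2)) := by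
        rw [mul_assoc]
        exact mul_le_mul hcK (mul_le_mul_of_nonneg_right hLK hY0) (by positivity) zero_le_one
    _ = L ^ M * thetaErrSum R H₁ H₂ N + L ^ M * ((2 * Real.log R + h₀ * Real.log ((N + h₀ : ℕ) : ℝ)) *
          sumDGen R ((#H₁ : ℝ) + #H₂) ^ 2) := by rw [one_mul, mul_add]
    _ ≤ C₇ * N / L ^ A + N / L ^ A := add_le_add hterm1 hterm2
    _ = (C₇ + 1) * N / L ^ A := by ring

/-! ### GPY §9, last paragraph: Proposition 2 from (9.14) and the main terms (9.15)–(9.23) -/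

/-- `mainTerm a b e R ≥ 1/E!` when `b ≤ a`, `e ≤ E` and `log R ≥ 1`. [folklore] -/
theorem inv_factorial_le_mainTerm {a b e E : ℕ} (hab : b ≤ a) (he : e ≤ E) {R : ℝ}
    (hR : 1 ≤ Real.log R) : ((E.factorial : ℝ))⁻¹ ≤ mainTerm a b e R := by
  unfold mainTerm
  have h1 : (1 : ℝ) ≤ a.choose b := by exact_mod_cast Nat.choose_pos hab
  have h2 : (1 : ℝ) ≤ Real.log R ^ e := one_le_pow₀ hR
  have h3 : (e.factorial : ℝ) ≤ E.factorial := by exact_mod_cast Nat.factorial_le he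
  have h4 : (0 : ℝ) < e.factorial := by exact_mod_cast Nat.factorial_pos e
  have h5 : (0 : ℝ) < E.factorial := by exact_mod_cast Nat.factorial_pos E
  calc ((E.factorial : ℝ))⁻¹ ≤ ((e.factorial : ℝ))⁻¹ := inv_anti₀ h4 h3
    _ = 1 * 1 / (e.factorial : ℝ) := by ring
    _ ≤ (a.choose b : ℝ) * Real.log R ^ e / (e.factorial : ℝ) :=
        div_le_div_of_nonneg_right (mul_le_mul h1 h2 zero_le_one (by linarith)) h4.le

/-- The `ε/2 + ε/2` step of the last paragraph of GPY §9: `|S̃ − N𝒯̃| ≤ E`, `|𝒯̃ − m𝔖| ≤ (δ/2)m`,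
`E ≤ (δ/2) m N` give `|S̃ − m 𝔖 N| ≤ δ m N`. [folklore] -/
theorem abs_sub_main_le_of_split {S T m s N E δ : ℝ} (hN : 0 ≤ N) (h1 : |S - N * T| ≤ E)
    (h2 : |T - m * s| ≤ δ / 2 * m) (h3 : E ≤ δ / 2 * (m * N)) :
    |S - m * s * N| ≤ δ * (m * N) := by
  have h4 : |N * T - m * s * N| = N * |T - m * s| := by
    rw [show N * T - m * s * N = N * (T - m * s) by ring, abs_mul, abs_of_nonneg hN]
  have h5 : N * |T - m * s| ≤ N * (δ / 2 * m) := mul_le_mul_of_nonneg_left h2 hN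
  calc |S - m * s * N| ≤ |S - N * T| + |N * T - m * s * N| := abs_sub_le _ _ _
    _ ≤ E + N * (δ / 2 * m) := by rw [h4]; linarith
    _ ≤ δ * (m * N) := by nlinarith

/-- **GPY Proposition 2 from its two halves.** The unconditional Proposition 2
(`Literature.NumberTheory.Sieve.GPY.proposition2`, (2.15)) follows from the reduction (9.14)
(`abs_sumTheta_sub_mainTRTheta_le_of_BV`, proved above from the Bombieri–Vinogradov theorem) and
the evaluation of the main term `𝒯̃_R(H₁, H₂, ℓ₁, ℓ₂, h₀)` — GPY (9.15)–(9.23) with Lemma 3 (§8),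
and the one-variable analogue of §6 when one of `H₁, H₂` is empty — which is taken here as the
HYPOTHESIS `hMT` (stated for `𝒯̃_R` = `mainTRTheta`, uniformly in `h ≤ R`, `1 ≤ h₀ ≤ h`,
`Hᵢ ⊆ [0, h]`, with relative error `δ`; it is what remains to be proved for
`proposition2_holds`). The proof is the last paragraph of §9: for `R ≤ A N^{1/4}/(log N)^{B+1}`,
`log N ≥ A`, the `O_M(N/log N)` of (9.14) and `δ/2` of the main term are each at most `δ/2` of
`mainTerm · N ≥ N/(M+1)!`. [cite: GoldstonPintzYildirim2009, Section 9 eq. 9.5] -/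
theorem proposition2_of_mainTerm
    (hMT : ∀ (M : ℕ) (δ : ℝ), 0 < δ → ∃ R₀ : ℝ, ∀ (R : ℝ) (h h₀ : ℕ) (H₁ H₂ : Finset ℕ) (ℓ₁ ℓ₂ : ℕ),
      R₀ ≤ R → (h : ℝ) ≤ R → 1 ≤ h₀ → h₀ ≤ h →
      (∀ x ∈ H₁, x ≤ h) → (∀ x ∈ H₂, x ≤ h) → (H₁.Nonempty ∨ H₂.Nonempty) →
      ℓ₁ ≤ #H₁ → ℓ₂ ≤ #H₂ → #H₁ + #H₂ + ℓ₁ + ℓ₂ = M →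
      (h₀ ∉ H₁ ∪ H₂ →
        |mainTRTheta R H₁ H₂ ℓ₁ ℓ₂ h₀ -
            mainTerm (ℓ₁ + ℓ₂) ℓ₁ (#(H₁ ∩ H₂) + ℓ₁ + ℓ₂) R *
              singularSeriesNat (insert h₀ (H₁ ∪ H₂))| ≤
          δ * mainTerm (ℓ₁ + ℓ₂) ℓ₁ (#(H₁ ∩ H₂) + ℓ₁ + ℓ₂) R) ∧
      (h₀ ∈ H₁ → h₀ ∉ H₂ →
        |mainTRTheta R H₁ H₂ ℓ₁ ℓ₂ h₀ -
            mainTerm (ℓ₁ + ℓ₂ + 1) (ℓ₁ + 1) (#(H₁ ∩ H₂) + ℓ₁ + ℓ₂ + 1) R *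
              singularSeriesNat (H₁ ∪ H₂)| ≤
          δ * mainTerm (ℓ₁ + ℓ₂ + 1) (ℓ₁ + 1) (#(H₁ ∩ H₂) + ℓ₁ + ℓ₂ + 1) R) ∧
      (h₀ ∈ H₁ ∩ H₂ →
        |mainTRTheta R H₁ H₂ ℓ₁ ℓ₂ h₀ -
            mainTerm (ℓ₁ + ℓ₂ + 2) (ℓ₁ + 1) (#(H₁ ∩ H₂) + ℓ₁ + ℓ₂ + 1) R *
              singularSeriesNat (H₁ ∪ H₂)| ≤
          δ * mainTerm (ℓ₁ + ℓ₂ + 2) (ℓ₁ + 1) (#(H₁ ∩ H₂) + ℓ₁ + ℓ₂ + 1) R)) :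
    proposition2 := by
  intro M
  obtain ⟨B₁, C₁, hB₁, N₁, hC1⟩ := abs_sumTheta_sub_mainTRTheta_le_of_BV M 1
  refine ⟨B₁ + 1, by linarith, ?_⟩
  intro A δ hA hδ
  obtain ⟨R₀', hMT'⟩ := hMT M (δ / 2) (by linarith)
  set T : ℝ := max A (2 * |C₁| * ((M + 1).factorial : ℝ) / δ) with hT
  refine ⟨max (max R₀' 3) (max (N₁ : ℝ) (Real.exp T)), ?_⟩
  intro R N h h₀ H₁ H₂ ℓ₁ ℓ₂ hR hN hRle hh hh₀1 hh₀h hH₁ hH₂ hne hℓ₁ hℓ₂ hM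
  -- thresholds
  have hR₀' : R₀' ≤ R := (le_max_left _ _).trans ((le_max_left _ _).trans hR)
  have hR3 : (3 : ℝ) ≤ R := (le_max_right _ _).trans ((le_max_left _ _).trans hR)
  have hNN₁ : (N₁ : ℝ) ≤ N := (le_max_left _ _).trans ((le_max_right _ _).trans hN)
  have hNT : Real.exp T ≤ N := (le_max_right _ _).trans ((le_max_right _ _).trans hN)
  have hN3 : (3 : ℝ) ≤ N := (le_max_right _ _).trans ((le_max_left _ _).trans hN)
  have hN₁ : N₁ ≤ N := by exact_mod_cast hNN₁
  have hN0 : (0 : ℝ) < N := by linarith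
  have hR1 : 1 ≤ R := by linarith
  have hlogN : T ≤ Real.log N := (Real.le_log_iff_exp_le hN0).2 hNT
  have hAlog : A ≤ Real.log N := (le_max_left _ _).trans hlogN
  have hClog : 2 * |C₁| * ((M + 1).factorial : ℝ) / δ ≤ Real.log N := (le_max_right _ _).trans hlogN
  have hlogN0 : 0 < Real.log N := lt_of_lt_of_le hA hAlog
  have hlogR : 1 ≤ Real.log R := by
    rw [Real.le_log_iff_exp_le (by linarith)]
    have : Real.exp 1 < 3 := Real.exp_one_lt_d9.trans (by norm_num)
    linarith
  -- the range of (9.14): `R ≤ A N^{1/4}/(log N)^{B₁+1} ≤ N^{1/4}/(log N)^{B₁}`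
  have hRle' : R ≤ (N : ℝ) ^ (1 / 4 : ℝ) / Real.log N ^ B₁ := by
    have hsplit : Real.log N ^ (B₁ + 1) = Real.log N ^ B₁ * Real.log N := by
      rw [Real.rpow_add hlogN0, Real.rpow_one]
    have hB0 : 0 < Real.log N ^ B₁ := Real.rpow_pos_of_pos hlogN0 B₁
    have hN4 : 0 ≤ (N : ℝ) ^ (1 / 4 : ℝ) := Real.rpow_nonneg hN0.le _
    have hAdiv : A / Real.log N ≤ 1 := (div_le_one hlogN0).2 hAlog
    calc R ≤ A * (N : ℝ) ^ (1 / 4 : ℝ) / Real.log N ^ (B₁ + 1) := hRle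
      _ = (A / Real.log N) * ((N : ℝ) ^ (1 / 4 : ℝ) / Real.log N ^ B₁) := by
          rw [hsplit]; field_simp
      _ ≤ 1 * ((N : ℝ) ^ (1 / 4 : ℝ) / Real.log N ^ B₁) :=
          mul_le_mul_of_nonneg_right hAdiv (div_nonneg hN4 hB0.le)
      _ = (N : ℝ) ^ (1 / 4 : ℝ) / Real.log N ^ B₁ := one_mul _
  have hh₀R : (h₀ : ℝ) ≤ R := le_trans (by exact_mod_cast hh₀h) hh
  -- (9.14)
  have h914 := hC1 R N h₀ H₁ H₂ ℓ₁ ℓ₂ hN₁ hR1 hRle' hh₀R hne hM.le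
  rw [Real.rpow_one] at h914
  -- the main terms
  obtain ⟨m1, m2, m3⟩ := hMT' R h h₀ H₁ H₂ ℓ₁ ℓ₂ hR₀' hh hh₀1 hh₀h hH₁ hH₂ hne hℓ₁ hℓ₂ hM
  -- `C₁ N / log N ≤ (δ/2) · N/(M+1)!`
  have hfac0 : (0 : ℝ) < ((M + 1).factorial : ℝ) := by exact_mod_cast Nat.factorial_pos _
  have hErr : C₁ * N / Real.log N ≤ δ / 2 * ((((M + 1).factorial : ℝ))⁻¹ * N) := by
    have h1 : C₁ * N / Real.log N ≤ |C₁| * N / Real.log N :=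
      div_le_div_of_nonneg_right (mul_le_mul_of_nonneg_right (le_abs_self C₁) hN0.le) hlogN0.le
    have h2 : |C₁| / Real.log N ≤ δ / 2 * (((M + 1).factorial : ℝ))⁻¹ := by
      rw [div_le_iff₀ hlogN0]
      rw [div_le_iff₀ hδ] at hClog
      have : δ / 2 * (((M + 1).factorial : ℝ))⁻¹ * Real.log N =
          Real.log N * δ / (2 * ((M + 1).factorial : ℝ)) := by field_simp
      rw [this, le_div_iff₀ (by positivity)]
      nlinarith [abs_nonneg C₁]
    calc C₁ * N / Real.log N ≤ |C₁| * N / Real.log N := h1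
      _ = N * (|C₁| / Real.log N) := by ring
      _ ≤ N * (δ / 2 * (((M + 1).factorial : ℝ))⁻¹) := mul_le_mul_of_nonneg_left h2 hN0.le
      _ = δ / 2 * ((((M + 1).factorial : ℝ))⁻¹ * N) := by ring
  have hr : #(H₁ ∩ H₂) ≤ #H₁ := Finset.card_le_card Finset.inter_subset_left
  have hErr' : ∀ {a b e : ℕ}, b ≤ a → e ≤ M + 1 →
      C₁ * N / Real.log N ≤ δ / 2 * (mainTerm a b e R * N) := by
    intro a b e hab he
    refine hErr.trans (mul_le_mul_of_nonneg_left ?_ (by linarith))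
    exact mul_le_mul_of_nonneg_right (inv_factorial_le_mainTerm hab he hlogR) hN0.le
  refine ⟨fun hno => ?_, fun hi1 hi2 => ?_, fun hi12 => ?_⟩
  · exact abs_sub_main_le_of_split hN0.le h914 (m1 hno) (hErr' (by omega) (by omega))
  · exact abs_sub_main_le_of_split hN0.le h914 (m2 hi1 hi2) (hErr' (by omega) (by omega))
  · exact abs_sub_main_le_of_split hN0.le h914 (m3 hi12) (hErr' (by omega) (by omega))

end Literature.NumberTheory.Sieve.GPY
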